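import Summits.Langlands.Langlands.Theses.NonParallelVoid
import Literature.NumberTheory.Automorphic.Eigenvariety
import Literature.NumberTheory.Automorphic.ClozelPurityProofs

/-!
# Sketch — first lemmas of the crux idea `eigenvariety-slope-void` (lens: negation) for
`NonParallelVoid.ResidueParallel` (stmt-Langlands-17003).  Strategist scratch; statements only (sorry).

* `slopeWindow_of_crystalline_noFlag` — the LOCAL obstruction found by the counterexample hunt: a crystalline
  `ρ|Γ_{F_v}` with the same two labelled Hodge–Tate weights `{a < b}` at every label of `v` and NO invariant line has
  every eigenvalue `α` of a geometric Frobenius of its Weil–Deligne representation (pinned Fontaine datum) in the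
  OPEN `q_v`-adic window `(a, b)`: `|q_v|^b < |α| < |q_v|^a` (weak admissibility: Newton on or above Hodge, and a
  boundary slope would split off a weakly admissible rank-one sub-object = an invariant line).  For `F_v = ℚ_p` this is
  "de Rham + locally irreducible ⇒ numerically small slope at `v`" — the step that makes the Bianchi control theorem bite.
* `parallel_of_cuspidal_regularAlgebraic` — the ENDGAME in tree vocabulary (provable now from the tree's
  `CuspidalAutomorphicRepData.purity`, Clozel 1990 Lemme 4.9): a regular algebraic cuspidal `π` on `GL₂(𝔸_F)` has the
  same gap between its two `z`-exponents at conjugate embeddings — "classical cusp forms exist only at parallel weights".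
-/

noncomputable section

set_option linter.dupNamespace false

open scoped NumberField
open NumberField IsDedekindDomain Field
open Literature.NumberTheory.GaloisRepresentations Literature.NumberTheory.PAdicHodge
open Literature.NumberTheory.Automorphic

namespace Summit.Langlands.Langlands.Cruxes.ResidueParallel.EigenvarietySlopeVoid

/-- FIRST LEMMA (local slope window). [cite: ColmezFontaine2000, Thm A (weakly admissible ⇒ admissible)]
[cite: BarnetlambEtAl2014, §1.4] -/
theorem slopeWindow_of_crystalline_noFlag :
    ∀ (F : Type) [Field F] [NumberField F] (p : ℕ) [Fact p.Prime]
      (ρ : FramedGaloisRep F (PadicAlgCl p) 2)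
      (v : HeightOneSpectrum (𝓞 F)) (hv : ((p : ℕ) : 𝓞 F) ∈ v.asIdeal),
      (fontainePstAdicCompletion v p hv).IsCrystallineFramed (ρ.toLocal v) →
      ¬ FramedRep.HasInvariantCompleteFlag (ρ.toLocal v) →
      ∀ (a b : ℤ), a < b →
      (letI := (fontainePstAdicCompletion v p hv).algebra
       ∀ τ : v.adicCompletion F →ₐ[ℚ_[p]] PadicAlgCl p,
         ρ.labelledHodgeTateWeightsAt v (fontainePstAdicCompletion v p hv).algebra
           (fontainePstAdicCompletion v p hv).𝔅 τ.toRingHom = {a, b}) →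
      ∀ r : WeilDeligneRep (v.adicCompletion F) (PadicAlgCl p) (Fin 2 → PadicAlgCl p),
        (fontainePstAdicCompletion v p hv).IsWeilDeligneOf (ρ.toLocal v) r →
      ∀ w : WeilGroup (v.adicCompletion F), WeilGroup.deg w = -1 →
      ∀ α : PadicAlgCl p, Module.End.HasEigenvalue (r.ρ w) α →
        ((Valued.v : Valuation (PadicAlgCl p) NNReal) ((v.residueCard : ℕ) : PadicAlgCl p) ^ b <
              (Valued.v : Valuation (PadicAlgCl p) NNReal) α ∧
            (Valued.v : Valuation (PadicAlgCl p) NNReal) α <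
              (Valued.v : Valuation (PadicAlgCl p) NNReal) ((v.residueCard : ℕ) : PadicAlgCl p) ^ a) ∨
          -- the same window under the opposite Frobenius-eigenvalue sign convention (the pinned datum fixes the
          -- convention only on unramified representations, `FontaineDpst` (F8); a crux-plan keeps one disjunct once
          -- the construction D2 `WD ∘ D_pst` lands)
          ((Valued.v : Valuation (PadicAlgCl p) NNReal) ((v.residueCard : ℕ) : PadicAlgCl p) ^ (-a) <
              (Valued.v : Valuation (PadicAlgCl p) NNReal) α ∧
            (Valued.v : Valuation (PadicAlgCl p) NNReal) α <
              (Valued.v : Valuation (PadicAlgCl p) NNReal) ((v.residueCard : ℕ) : PadicAlgCl p) ^ (-b)) := by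
  sorry

/-- ENDGAME (Clozel purity ⇒ parallel gaps for `GL₂` over an imaginary quadratic field), stated on infinity types:
the multiset of `z`-exponents at the conjugate embedding is the reflection `a ↦ w − a` of the one at `ι`, so the two
gaps agree. [cite: Clozel1990, Lemme 4.9] -/
theorem parallel_of_cuspidal_regularAlgebraic :
    ∀ (F : Type) [Field F] [NumberField F] (hcpt : isCompact_glFiniteIntegralLevel 2 F)
      (π : CuspidalAutomorphicRepData 2 F hcpt) (T : InfinityType F 2),
      π.1.HasInfinityType T → T.IsRegularAlgebraic →
      ∀ ι : F →+* ℂ, ∃ w : ℤ,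
        (T ((starRingEnd ℂ).comp ι)).map ArchWeight.a = ((T ι).map ArchWeight.a).map fun a => (w : ℂ) - a := by
  intro F _ _ hcpt π T hT hreg ι
  obtain ⟨w, hw⟩ := π.purity hT hreg
  exact ⟨w, hw ι⟩

end Summit.Langlands.Langlands.Cruxes.ResidueParallel.EigenvarietySlopeVoid

end
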